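import Summits.CriticalPhenomena.PercolationContinuityZ3.Theorems.PercNearOneGluingNoHeavyLowerTailKnQuestion8CoefficientwiseCoreClassSeriesMain
import Summits.CriticalPhenomena.PercolationContinuityZ3.Theorems.PercNearOneGluingNoHeavyLowerTailKnQuestion8CoefficientwiseCoreClassKernelMixFull
import Summits.CriticalPhenomena.PercolationContinuityZ3.Theorems.PercNearOneGluingNoHeavyLowerTailKnQuestion8CoefficientwiseCoreClassDomLeafClusters
import HarnessLib

/-!
# THEOREM KB-DECOR: KB-MIX-FULL is stable under decorations (anything glued at a single vertex)

Support file (`--supports stmt-CriticalPhenomena-4575`, closed), prover `prim-cplus-coupling` (gen 35).  No definitions, no notations, no named facts,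
no sorries; standard axioms.  Memo `prim-cplus-coupling/A5-COUPLING-gen35.md` §1.  Companions `…CoreClassKernelMixFull` (KB-MIX-FULL, leaf step),
`…CoreClassSeriesMain` (series step), `…CoreClassDomLeafClusters` (`sum_mul_sdiff_le_sum_mul`, Harris in product form).

Setting: a finite multigraph `ends : ι → Sym2 V`, a middle graph `E` with terminals `a, b`, and a DECORATION `D`: an edge set disjoint from `E`
whose edges meet the edges of `E` only at one vertex `v` (the terminals may be vertices of `D` only if they equal `v`).  Colourings of `E ∪ D`
are pairs `(ω, ε)`; write `C_x(·) = openCluster`, `X(ε) = C_v(ε)` (the part of the decoration red-joined to `v`).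
* `Coefficientwise.openCluster_union_decor` — `C_x(ω ∪ ε) = C_x(ω) ∪ {w | v ∈ C_x(ω), w ∈ X(ε)}` for every root `x` that is not a vertex of
  `D` other than `v`: the decoration joins the cluster of `x` exactly when `v` does.
* `Coefficientwise.decor_harris_step` — for monotone `F, F', G, G'` on `2^D`:
  `Σ_ε (F ε − G(D∖ε))(F' ε − G'(D∖ε)) ≥ Σ_ε (F ε − G ε)(F' ε − G' ε)` (two applications of Harris in product form plus the complement
  reindexing; the 'reddened twin' mechanism (I2) of memo gen 30 §3).
* `Coefficientwise.coreClass_kernelMixFull_decor` — **THEOREM KB-DECOR.**  If KB-MIX-FULL holds for `(E; a, b)` at the GLUED levels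
  `φ_ε(Y) = φ(Y ∪ {w | v ∈ Y, w ∈ X(ε)})` for every `ε ⊆ D` (one instance of KB-MIX-FULL of `E` per colouring of the decoration), then
  KB-MIX-FULL holds for `(E ∪ D; a, b)` at the levels `(h, k; hᵃ, hᵇ; kᵃ, kᵇ)`.  Proof: the wall of `E ∪ D` is `wall(E) × 2^D`; on it
  `C_a(ω ∪ ε) = P ∪ [v ∈ P]X(ε)` and `C_b` of the complement is `Q ∪ [v ∈ Q]X(D∖ε)`; the supply of `E ∪ D` is exactly the sum over `ε` of the
  glued supplies, and for each wall colouring `ω` of `E` the sum over `ε` of the true wall terms dominates the sum of the glued wall terms by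
  `decor_harris_step`.  In particular (equal levels) the KERNEL KB and hence CW-PA on the core class `N(x) = N(z) = {a, b}` are decoration-stable
  inside the KB-MIX calculus (domination maps are not: DOM fails for decorated graphs, memo gen 30 §0(4)).
[cite: KozmaNitzan2024, Questions 8–9 (§5.5 p. 36) (context: the Question-8 pocket covariance programme)]
-/

namespace Summit.CriticalPhenomena.PercolationContinuityZ3.Theorems

open Finset Literature.Probability.Percolation

namespace Coefficientwise

variable {ι V : Type*}

open Classical in
/-- **Clusters of a decorated graph.**  `E, D` edge sets whose edges share no vertex other than `v`; `ω ⊆ E`, `ε ⊆ D`; a root `x` which lies on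
an edge of `D` only if `x = v`.  Then `C_x(ω ∪ ε) = C_x(ω) ∪ {w | v ∈ C_x(ω) ∧ w ∈ C_v(ε)}`. [cite: KozmaNitzan2024, §5.5 (context only; folklore)] -/
theorem openCluster_union_decor (ends : ι → Sym2 V) (E D ω ε : Finset ι) (v x : V)
    (hsep : ∀ i ∈ E, ∀ j ∈ D, ∀ w, w ∈ ends i → w ∈ ends j → w = v)
    (hx : ∀ j ∈ D, x ∈ ends j → x = v) (hω : ω ⊆ E) (hε : ε ⊆ D) :
    openCluster (ends '' (↑(ω ∪ ε) : Set ι)) x =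
      openCluster (ends '' (↑ω : Set ι)) x ∪ {w | v ∈ openCluster (ends '' (↑ω : Set ι)) x ∧ w ∈ openCluster (ends '' (↑ε : Set ι)) v} := by
  set S : Set V := openCluster (ends '' (↑ω : Set ι)) x ∪
    {w | v ∈ openCluster (ends '' (↑ω : Set ι)) x ∧ w ∈ openCluster (ends '' (↑ε : Set ι)) v} with hS
  apply Set.Subset.antisymm
  · refine openCluster_subset_of_closed ends (ω ∪ ε) x (S := S) (Or.inl (mem_openCluster_self _ _)) ?_
    intro i hi p q he hp
    rcases Finset.mem_union.mp hi with hiω | hiε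
    · -- an `E`-edge: its end `p` lies in `C_x(ω)` (if `p` came from the decoration part it is `v`)
      have hpω : p ∈ openCluster (ends '' (↑ω : Set ι)) x := by
        rcases hp with hp | ⟨hv, hpv⟩
        · exact hp
        · by_cases hpv' : p = v
          · rw [hpv']; exact hv
          · obtain ⟨j, hj, hpj⟩ := exists_edge_of_mem_openCluster ends hpv hpv'
            have := hsep i (hω hiω) j (hε hj) p (by rw [he]; exact Sym2.mem_mk_left p q) hpj
            exact absurd this hpv'
      exact Or.inl (mem_openCluster_of_edge ends hiω he hpω)
    · -- a `D`-edge: its end `p` is `v` or lies in the decoration part; either way `v ∈ C_x(ω)` and `q ∈ C_v(ε)`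
      have hpi : p ∈ ends i := by rw [he]; exact Sym2.mem_mk_left p q
      have key : v ∈ openCluster (ends '' (↑ω : Set ι)) x ∧ p ∈ openCluster (ends '' (↑ε : Set ι)) v := by
        rcases hp with hp | ⟨hv, hpv⟩
        · have hpv : p = v := by
            by_cases hpx : p = x
            · rw [hpx]; exact hx i (hε hiε) (hpx ▸ hpi)
            · obtain ⟨i', hi', hpi'⟩ := exists_edge_of_mem_openCluster ends hp hpx
              exact hsep i' (hω hi') i (hε hiε) p hpi' hpi
          subst hpv
          exact ⟨hp, mem_openCluster_self _ _⟩
        · exact ⟨hv, hpv⟩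
      exact Or.inr ⟨key.1, mem_openCluster_of_edge ends hiε he key.2⟩
  · intro w hw
    rcases hw with hw | ⟨hv, hwv⟩
    · exact openCluster_image_mono ends Finset.subset_union_left x hw
    · have h1 : v ∈ openCluster (ends '' (↑(ω ∪ ε) : Set ι)) x := openCluster_image_mono ends Finset.subset_union_left x hv
      have h2 : w ∈ openCluster (ends '' (↑(ω ∪ ε) : Set ι)) v := openCluster_image_mono ends Finset.subset_union_right v hwv
      exact SimpleGraph.Reachable.trans h1 h2

/-- Harris in product form, twice, with the complement reindexing: for monotone `F, F', G, G'` on the subsets of `D`,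
`Σ_ε (F ε − G ε)(F' ε − G' ε) ≤ Σ_ε (F ε − G(D∖ε))(F' ε − G'(D∖ε))`. [cite: KozmaNitzan2024, §5.5 (context: Harris 1960)] -/
theorem decor_harris_step [DecidableEq ι] (D : Finset ι) (F F' G G' : Finset ι → ℝ)
    (hF : Monotone F) (hF' : Monotone F') (hG : Monotone G) (hG' : Monotone G') :
    ∑ ε ∈ D.powerset, (F ε - G ε) * (F' ε - G' ε) ≤ ∑ ε ∈ D.powerset, (F ε - G (D \ ε)) * (F' ε - G' (D \ ε)) := by
  have e : ∀ ε, (F ε - G (D \ ε)) * (F' ε - G' (D \ ε)) - (F ε - G ε) * (F' ε - G' ε) =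
      (F ε * G' ε - F ε * G' (D \ ε)) + (F' ε * G ε - F' ε * G (D \ ε)) + (G (D \ ε) * G' (D \ ε) - G ε * G' ε) := by
    intro ε; ring
  have h1 := sum_mul_sdiff_le_sum_mul D F G' hF hG'
  have h2 := sum_mul_sdiff_le_sum_mul D F' G hF' hG
  have h3 : ∑ ε ∈ D.powerset, G (D \ ε) * G' (D \ ε) = ∑ ε ∈ D.powerset, G ε * G' ε :=
    sum_powerset_sdiff D (fun ε => G ε * G' ε)
  have hdiff : ∑ ε ∈ D.powerset, ((F ε - G (D \ ε)) * (F' ε - G' (D \ ε)) - (F ε - G ε) * (F' ε - G' ε)) =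
      ((∑ ε ∈ D.powerset, F ε * G' ε) - ∑ ε ∈ D.powerset, F ε * G' (D \ ε))
        + ((∑ ε ∈ D.powerset, F' ε * G ε) - ∑ ε ∈ D.powerset, F' ε * G (D \ ε))
        + ((∑ ε ∈ D.powerset, G (D \ ε) * G' (D \ ε)) - ∑ ε ∈ D.powerset, G ε * G' ε) := by
    rw [Finset.sum_congr rfl fun ε _ => e ε, Finset.sum_add_distrib, Finset.sum_add_distrib,
      Finset.sum_sub_distrib, Finset.sum_sub_distrib, Finset.sum_sub_distrib]
  have hnonneg : 0 ≤ ∑ ε ∈ D.powerset, ((F ε - G (D \ ε)) * (F' ε - G' (D \ ε)) - (F ε - G ε) * (F' ε - G' ε)) := by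
    rw [hdiff, h3]; linarith
  rw [Finset.sum_sub_distrib] at hnonneg
  linarith

open Classical in
/-- **THEOREM KB-DECOR (KB-MIX-FULL is decoration-stable).**  `E, D` disjoint edge sets whose edges share no vertex other than `v`; the terminals
`a, b` lie on edges of `D` only if equal to `v`; monotone levels `hᵃ, hᵇ, kᵃ, kᵇ`.  Hypothesis: for every colouring `ε ⊆ D` of the decoration,
KB-MIX-FULL of `(E; a, b)` at the glued test functions `φ_ε(Y) = φ(Y ∪ {w | v ∈ Y ∧ w ∈ C_v(ε)})` (`φ ∈ {h, k, hᵃ, hᵇ, kᵃ, kᵇ}`):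
`0 ≤ Σ_{ω ⊆ E} h_ε(S)k_ε(S) + Σ_{ω : b ∉ C_a ω, b ∉ C_a(E∖ω)} (hᵃ_ε(C_a ω) − hᵇ_ε(C_b(E∖ω)))(kᵃ_ε(C_a ω) − kᵇ_ε(C_b(E∖ω)))` (`S = C_a ω ∪ C_b ω`).
Conclusion: KB-MIX-FULL of `(E ∪ D; a, b)` at `(h, k; hᵃ, hᵇ; kᵃ, kᵇ)`.  (The glued functions inherit monotonicity, nonnegativity and the level
bounds `φᵃ_ε ≤ φ_ε`, so the hypothesis is an instance of KB-MIX-FULL of `E` 'for all levels'.)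
[cite: KozmaNitzan2024, Questions 8–9 (§5.5 p. 36) (context: the Question-8 pocket covariance programme)] -/
theorem coreClass_kernelMixFull_decor (ends : ι → Sym2 V) (E D : Finset ι) (v a b : V) (hED : Disjoint E D)
    (hsep : ∀ i ∈ E, ∀ j ∈ D, ∀ w, w ∈ ends i → w ∈ ends j → w = v)
    (haD : ∀ j ∈ D, a ∈ ends j → a = v) (hbD : ∀ j ∈ D, b ∈ ends j → b = v)
    (h k ha hb ka kb : Set V → ℝ) (mha : Monotone ha) (mhb : Monotone hb) (mka : Monotone ka) (mkb : Monotone kb)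
    (hmix : ∀ ε, ε ⊆ D → 0 ≤ (∑ ω ∈ E.powerset,
        h ((openCluster (ends '' (↑ω : Set ι)) a ∪ openCluster (ends '' (↑ω : Set ι)) b) ∪
            {w | v ∈ (openCluster (ends '' (↑ω : Set ι)) a ∪ openCluster (ends '' (↑ω : Set ι)) b) ∧ w ∈ openCluster (ends '' (↑ε : Set ι)) v}) *
          k ((openCluster (ends '' (↑ω : Set ι)) a ∪ openCluster (ends '' (↑ω : Set ι)) b) ∪
            {w | v ∈ (openCluster (ends '' (↑ω : Set ι)) a ∪ openCluster (ends '' (↑ω : Set ι)) b) ∧ w ∈ openCluster (ends '' (↑ε : Set ι)) v}))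
      + ∑ ω ∈ E.powerset.filter (fun ω : Finset ι => b ∉ openCluster (ends '' (↑ω : Set ι)) a ∧ b ∉ openCluster (ends '' (↑(E \ ω) : Set ι)) a),
        (ha (openCluster (ends '' (↑ω : Set ι)) a ∪ {w | v ∈ openCluster (ends '' (↑ω : Set ι)) a ∧ w ∈ openCluster (ends '' (↑ε : Set ι)) v})
          - hb (openCluster (ends '' (↑(E \ ω) : Set ι)) b ∪ {w | v ∈ openCluster (ends '' (↑(E \ ω) : Set ι)) b ∧ w ∈ openCluster (ends '' (↑ε : Set ι)) v})) *
        (ka (openCluster (ends '' (↑ω : Set ι)) a ∪ {w | v ∈ openCluster (ends '' (↑ω : Set ι)) a ∧ w ∈ openCluster (ends '' (↑ε : Set ι)) v})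
          - kb (openCluster (ends '' (↑(E \ ω) : Set ι)) b ∪ {w | v ∈ openCluster (ends '' (↑(E \ ω) : Set ι)) b ∧ w ∈ openCluster (ends '' (↑ε : Set ι)) v}))) :
    0 ≤ (∑ ω ∈ (E ∪ D).powerset,
        h (openCluster (ends '' (↑ω : Set ι)) a ∪ openCluster (ends '' (↑ω : Set ι)) b) *
          k (openCluster (ends '' (↑ω : Set ι)) a ∪ openCluster (ends '' (↑ω : Set ι)) b))
      + ∑ ω ∈ (E ∪ D).powerset.filter (fun ω : Finset ι => b ∉ openCluster (ends '' (↑ω : Set ι)) a ∧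
            b ∉ openCluster (ends '' (↑((E ∪ D) \ ω) : Set ι)) a),
        (ha (openCluster (ends '' (↑ω : Set ι)) a) - hb (openCluster (ends '' (↑((E ∪ D) \ ω) : Set ι)) b)) *
          (ka (openCluster (ends '' (↑ω : Set ι)) a) - kb (openCluster (ends '' (↑((E ∪ D) \ ω) : Set ι)) b)) := by
  set C : Finset ι → V → Set V := fun ω x => openCluster (ends '' (↑ω : Set ι)) x with hC
  -- glued quantities
  set Sg : Finset ι → Finset ι → Set V := fun ω ε => (C ω a ∪ C ω b) ∪ {w | v ∈ (C ω a ∪ C ω b) ∧ w ∈ C ε v} with hSg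
  set Fa : Finset ι → Finset ι → ℝ := fun ω ε => ha (C ω a ∪ {w | v ∈ C ω a ∧ w ∈ C ε v}) with hFa
  set Ka : Finset ι → Finset ι → ℝ := fun ω ε => ka (C ω a ∪ {w | v ∈ C ω a ∧ w ∈ C ε v}) with hKa
  set Gb : Finset ι → Finset ι → ℝ := fun ω ε => hb (C (E \ ω) b ∪ {w | v ∈ C (E \ ω) b ∧ w ∈ C ε v}) with hGb
  set Kb : Finset ι → Finset ι → ℝ := fun ω ε => kb (C (E \ ω) b ∪ {w | v ∈ C (E \ ω) b ∧ w ∈ C ε v}) with hKb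
  set TE : Finset (Finset ι) := E.powerset.filter (fun ω : Finset ι => b ∉ C ω a ∧ b ∉ C (E \ ω) a) with hTE
  change ∀ ε, ε ⊆ D → 0 ≤ (∑ ω ∈ E.powerset, h (Sg ω ε) * k (Sg ω ε))
      + ∑ ω ∈ TE, (Fa ω ε - Gb ω ε) * (Ka ω ε - Kb ω ε) at hmix
  change 0 ≤ (∑ ω ∈ (E ∪ D).powerset, h (C ω a ∪ C ω b) * k (C ω a ∪ C ω b))
      + ∑ ω ∈ (E ∪ D).powerset.filter (fun ω : Finset ι => b ∉ C ω a ∧ b ∉ C ((E ∪ D) \ ω) a),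
        (ha (C ω a) - hb (C ((E ∪ D) \ ω) b)) * (ka (C ω a) - kb (C ((E ∪ D) \ ω) b))
  -- (F1) clusters of the decorated graph
  have hclu : ∀ ω ε, ω ⊆ E → ε ⊆ D → ∀ x, (∀ j ∈ D, x ∈ ends j → x = v) →
      C (ω ∪ ε) x = C ω x ∪ {w | v ∈ C ω x ∧ w ∈ C ε v} :=
    fun ω ε hω hε x hx => openCluster_union_decor ends E D ω ε v x hsep hx hω hε
  -- (F2) complements split
  have hsd : ∀ ω ε, ω ⊆ E → ε ⊆ D → (E ∪ D) \ (ω ∪ ε) = (E \ ω) ∪ (D \ ε) :=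
    fun ω ε hω hε => sdiff_union_sdiff E D ω ε hED hω hε
  -- (F3) the wall does not see the decoration
  have hwall1 : ∀ ω ε, ω ⊆ E → ε ⊆ D → (b ∈ C (ω ∪ ε) a ↔ b ∈ C ω a) := by
    intro ω ε hω hε
    rw [hclu ω ε hω hε a haD]
    constructor
    · rintro (hb1 | ⟨hv, hbv⟩)
      · exact hb1
      · by_cases hbv' : b = v
        · rw [hbv']; exact hv
        · obtain ⟨j, hj, hbj⟩ := exists_edge_of_mem_openCluster ends hbv hbv'
          exact absurd (hbD j (hε hj) hbj) hbv'
    · intro hb1; exact Or.inl hb1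
  have hwall : ∀ ω ε, ω ⊆ E → ε ⊆ D →
      ((b ∉ C (ω ∪ ε) a ∧ b ∉ C ((E ∪ D) \ (ω ∪ ε)) a) ↔ (b ∉ C ω a ∧ b ∉ C (E \ ω) a)) := by
    intro ω ε hω hε
    rw [hsd ω ε hω hε, hwall1 ω ε hω hε, hwall1 (E \ ω) (D \ ε) Finset.sdiff_subset Finset.sdiff_subset]
  -- Step A: the supply of `E ∪ D` is the sum of the glued supplies
  have hsetS : ∀ ω ε, ω ⊆ E → ε ⊆ D → C (ω ∪ ε) a ∪ C (ω ∪ ε) b = Sg ω ε := by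
    intro ω ε hω hε
    rw [hclu ω ε hω hε a haD, hclu ω ε hω hε b hbD]
    ext w; simp only [hSg, Set.mem_union, Set.mem_setOf_eq]; tauto
  have hA : ∑ ω ∈ (E ∪ D).powerset, h (C ω a ∪ C ω b) * k (C ω a ∪ C ω b) =
      ∑ ε ∈ D.powerset, ∑ ω ∈ E.powerset, h (Sg ω ε) * k (Sg ω ε) := by
    rw [sum_powerset_union_disjoint hED, Finset.sum_comm]
    refine Finset.sum_congr rfl fun ε hε => Finset.sum_congr rfl fun ω hω => ?_
    rw [hsetS ω ε (Finset.mem_powerset.mp hω) (Finset.mem_powerset.mp hε)]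
  -- Step B: the wall sum of `E ∪ D` in glued coordinates
  have hB : ∑ ω ∈ (E ∪ D).powerset.filter (fun ω : Finset ι => b ∉ C ω a ∧ b ∉ C ((E ∪ D) \ ω) a),
        (ha (C ω a) - hb (C ((E ∪ D) \ ω) b)) * (ka (C ω a) - kb (C ((E ∪ D) \ ω) b)) =
      ∑ ω ∈ TE, ∑ ε ∈ D.powerset, (Fa ω ε - Gb ω (D \ ε)) * (Ka ω ε - Kb ω (D \ ε)) := by
    rw [Finset.sum_filter, sum_powerset_union_disjoint hED, hTE, Finset.sum_filter]
    refine Finset.sum_congr rfl fun ω hω => ?_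
    have hωE : ω ⊆ E := Finset.mem_powerset.mp hω
    by_cases hw : (b ∉ C ω a ∧ b ∉ C (E \ ω) a)
    · rw [if_pos hw]
      refine Finset.sum_congr rfl fun ε hε => ?_
      have hεD : ε ⊆ D := Finset.mem_powerset.mp hε
      rw [if_pos ((hwall ω ε hωE hεD).mpr hw), hsd ω ε hωE hεD, hclu ω ε hωE hεD a haD,
        hclu (E \ ω) (D \ ε) Finset.sdiff_subset Finset.sdiff_subset b hbD]
    · rw [if_neg hw]
      refine Finset.sum_eq_zero fun ε hε => ?_
      have hεD : ε ⊆ D := Finset.mem_powerset.mp hε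
      rw [if_neg (fun h' => hw ((hwall ω ε hωE hεD).mp h'))]
  -- Step C: the hypotheses, summed over the colourings of the decoration
  have hCsum : 0 ≤ (∑ ε ∈ D.powerset, ∑ ω ∈ E.powerset, h (Sg ω ε) * k (Sg ω ε))
      + ∑ ω ∈ TE, ∑ ε ∈ D.powerset, (Fa ω ε - Gb ω ε) * (Ka ω ε - Kb ω ε) := by
    have h1 : 0 ≤ ∑ ε ∈ D.powerset, ((∑ ω ∈ E.powerset, h (Sg ω ε) * k (Sg ω ε))
        + ∑ ω ∈ TE, (Fa ω ε - Gb ω ε) * (Ka ω ε - Kb ω ε)) :=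
      Finset.sum_nonneg fun ε hε => hmix ε (Finset.mem_powerset.mp hε)
    rw [Finset.sum_add_distrib] at h1
    rw [Finset.sum_comm (s := TE)]
    exact h1
  -- Step D: Harris on the decoration, wall colouring by wall colouring
  have hmonoX : ∀ {ε ε' : Finset ι}, ε ≤ ε' → C ε v ⊆ C ε' v := fun hle => openCluster_image_mono ends hle v
  have hglue_mono : ∀ (Y : Set V) {ε ε' : Finset ι}, ε ≤ ε' →
      Y ∪ {w | v ∈ Y ∧ w ∈ C ε v} ⊆ Y ∪ {w | v ∈ Y ∧ w ∈ C ε' v} := by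
    intro Y ε ε' hle w hw
    rcases hw with hw | ⟨hv, hw⟩
    · exact Or.inl hw
    · exact Or.inr ⟨hv, hmonoX hle hw⟩
  have hD : ∑ ω ∈ TE, ∑ ε ∈ D.powerset, (Fa ω ε - Gb ω ε) * (Ka ω ε - Kb ω ε) ≤
      ∑ ω ∈ TE, ∑ ε ∈ D.powerset, (Fa ω ε - Gb ω (D \ ε)) * (Ka ω ε - Kb ω (D \ ε)) := by
    refine Finset.sum_le_sum fun ω _ => ?_
    exact decor_harris_step D (Fa ω) (Ka ω) (Gb ω) (Kb ω)
      (fun ε ε' hle => mha (hglue_mono _ hle)) (fun ε ε' hle => mka (hglue_mono _ hle))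
      (fun ε ε' hle => mhb (hglue_mono _ hle)) (fun ε ε' hle => mkb (hglue_mono _ hle))
  rw [hA, hB]
  linarith

end Coefficientwise

end Summit.CriticalPhenomena.PercolationContinuityZ3.Theorems
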